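import Summits.CriticalPhenomena.CardyFormulaZ2.Theorems.CardyWhiteToColouredSimilarityUpgradeStubSymmetricHalf
import Summits.CriticalPhenomena.CardyFormulaZ2.Theorems.CardyTensorRGPolyominoGaussianLawDyadicCores

/-!
# Every dyadic orbit of a lattice-symmetric conformal rectangle is crossed with probability `→ 1/2`
# (crux `PolyominoGaussianLaw`, stmt-CriticalPhenomena-14337, route `CardyTensorRG`, line `registered`,
# skeleton v8: auxiliary stub `stub_symmetricClassDyadic`)

Let `R = (Ω; a, b, c, d)` be a conformal rectangle and `σ z = u z̄`, `u ∈ {1, -1, i, -i}`, one of the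
four anti-linear lattice symmetries of `ℤ²`. If `σ(Ω) = Ω` and `σ` exchanges the two pairs of opposite
arcs of `R` (`σ(arc 0) = arc 1, σ(arc 2) = arc 3` or `σ(arc 0) = arc 3, σ(arc 2) = arc 1`), then for
every `δ₀ > 0` the bond-`ℤ²` crossing probabilities of `R` along the dyadic mesh sequence
`δ₀ · 2^(−k)` converge to `1/2`.

This is the full one-sided limit `bondDomainCrossingProb R δ → 1/2` as `δ → 0⁺` of the tree's
`SimilarityUpgrade.Stubs.stub_symmetricHalf` (limit self-duality `stub_dualSum` + exact lattice
symmetry of the crossing probability, mesh by mesh) read along the sequence `δ₀ · 2^(−k) → 0⁺`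
(`tendsto_dyadicMesh`). It records that the existence core `stub_dyadicLimitExists` of the line holds,
with the explicit limit `1/2`, on the whole lattice-symmetric class (arc-level symmetry only, no
condition on the marked points).

References: S. Smirnov, *Critical percolation in the plane*, C. R. Acad. Sci. Paris 333 (2001), §2;
G. R. Grimmett, *Percolation* (1999), §9.7 and Lemma 11.21 (self-duality at `p = 1/2`);
V. Beffara, *Cardy's formula on the triangular lattice, the easy way* (2007), proof of Prop. 4.
-/

noncomputable section

namespace Summit.CriticalPhenomena.CardyFormulaZ2.Cruxes.PolyominoGaussianLaw.Birth

open Filter Topology Set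
open Literature.Probability.RandomPlanarGeometry
open Literature.Probability.Percolation (bondDomainCrossingProb)
open Summit.CriticalPhenomena.CardyFormulaZ2.Cruxes.SimilarityUpgrade.Stubs (stub_symmetricHalf)

/-- aux stub 8 (v8). **Every dyadic orbit of a lattice-symmetric conformal rectangle is crossed with
probability `→ 1/2`**: if `σ z = u z̄` (`u ∈ {1, -1, i, -i}`) preserves the carrier of `R` and
exchanges its two pairs of opposite arcs, then for every `δ₀ > 0`,
`bondDomainCrossingProb R (δ₀ · 2^(−k)) → 1/2` as `k → ∞` — the full limit `stub_symmetricHalf`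
composed with the dyadic mesh sequence `tendsto_dyadicMesh`. [folklore] -/
theorem stub_symmetricClassDyadic :
    ∀ (R : Literature.Probability.RandomPlanarGeometry.ConformalRectangle) (u : ℂ),
      (u = 1 ∨ u = -1 ∨ u = Complex.I ∨ u = -Complex.I) →
      (fun z : ℂ => u * (starRingEnd ℂ) z) '' R.carrier = R.carrier →
      ((fun z : ℂ => u * (starRingEnd ℂ) z) '' R.arc 0 = R.arc 1 ∧
          (fun z : ℂ => u * (starRingEnd ℂ) z) '' R.arc 2 = R.arc 3 ∨
        (fun z : ℂ => u * (starRingEnd ℂ) z) '' R.arc 0 = R.arc 3 ∧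
          (fun z : ℂ => u * (starRingEnd ℂ) z) '' R.arc 2 = R.arc 1) →
      ∀ δ₀ : ℝ, 0 < δ₀ →
        Filter.Tendsto (fun k : ℕ => Literature.Probability.Percolation.bondDomainCrossingProb R (δ₀ / 2 ^ k))
          Filter.atTop (nhds (1 / 2)) := by
  intro R u hu hΩ harcs δ₀ hδ₀
  exact (stub_symmetricHalf R u hu hΩ harcs).comp (tendsto_dyadicMesh hδ₀)

end Summit.CriticalPhenomena.CardyFormulaZ2.Cruxes.PolyominoGaussianLaw.Birth

end
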